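import Literature.Computability.Complexity.CNF
import Literature.Computability.Complexity.StackMachines
import HarnessLib

/-!
# Certificates of non-tautology: the `NP` presentation of `TAUTᶜ` (towards `TAUT ∈ coNP`)

Arora–Barak (2009), Example 2.21: "TAUTOLOGY … is clearly in **coNP** by Definition 2.20" — a
falsifying assignment certifies that a formula is not a tautology. In the tree
`TAUT = encodingPropForm.toLanguage {φ | φ.IsTautology}` (`CNF.lean`) is a language of *all*
bit strings, `coNP = co (polyExists P)`, and the certificate checker has to be a polynomial-time
Turing machine in Mathlib's `TM2` model; so besides evaluating a formula it must recognise the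
codewords `encode φ = ⟨1^{|φ|}, code φ⟩` among all strings (a non-codeword is a non-member of
`TAUT`, to be *accepted* by the checker of the complement).

This file is the machine-independent half of the discharge of the named fact
`Literature.Computability.Complexity.TAUT_mem_coNP` (`CNF.lean`): it defines the checker `chkTaut w y` as a Boolean
function by structural recursions that a stack register program (`StackMachines.lean`) can
follow instruction by instruction, proves that it presents `TAUTᶜ` with linear-size
certificates, and reduces `TAUT ∈ coNP` to a polynomial-time implementation of `chkTaut`.

* Reading a codeword: `readHdr` (the unary size header `1ˢ` of `⟨1ˢ, c⟩`, two bits at a time),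
  the tokenizer `tokRun`/`tokenize` of the prefix code `PropForm.code` (one bit per step; it
  also checks that variable payloads are *canonical numerals*, `IsCanonicalNum` = the range of
  Mathlib's `encodeNat`, `isCanonicalNum_iff`), and the reverse-Polish parser `rpn`/`parseToks`
  (the token string read from its end with a stack). Each comes with completeness on genuine
  codes (`readHdr_boolPair_replicate`, `tokenize_untok`, `parseToks_toks`) and soundness
  (`readHdr_sound₀`, `tokenize_sound`, `parseToks_sound`: success reconstructs the input), so
  that `w` is a codeword iff all three succeed with matching token count
  (`chkTaut_of_not_mem_range`, `chkTaut_encode`).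
* The certificate: a table `y` of entries `⟨key, [value]⟩` read by `lookup`/`certAssignment`
  (first matching key wins, so every string `y` defines an assignment); `table σ keys` and
  `certAssignment_table`.
* `chkTaut w y` and the presentation **`not_mem_TAUT_iff`**:
  `w ∉ TAUT ↔ ∃ y, |y| ≤ |w| ∧ chkTaut w y = true`.
* **`TAUT_mem_coNP_of_checker`**: if some `f ∈ FP` with values in `{[true], [false]}` has
  `f ⟨w, y⟩ = [chkTaut w y]`, then `TAUT ∈ coNP` (`{z | f z = [true]} ∈ P`, `mem_P_of_boolValued`).

The polynomial-time implementation of `chkTaut` (a stack register program) is the other half.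

## References

* S. Arora, B. Barak, *Computational Complexity: A Modern Approach*, CUP 2009, Example 2.21
  (TAUTOLOGY ∈ coNP), Def. 2.1, Def. 2.19–2.20 (coNP by certificates), §0.1 (codes of formulas).
* S. A. Cook, *The complexity of theorem-proving procedures*, STOC 1971, §1 ({tautologies}).
* J. Łukasiewicz's parenthesis-free notation; reverse-Polish evaluation with a stack:
  A. W. Burks, D. W. Warren, J. B. Wright, *An analysis of a logical machine using
  parenthesis-free notation*, Math. Tables Aids Comput. 8 (1954) 53–57 (not held; folklore).
-/

namespace Literature.Computability.Complexity

open _root_.Computability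

universe u v

namespace PropForm

variable {ν : Type u} {μ : Type v}

/-- Relabelling of variables. [folklore] -/
def mapVars (f : ν → μ) : PropForm ν → PropForm μ
  | var x => var (f x)
  | const b => const b
  | neg φ => neg (φ.mapVars f)
  | conj φ ψ => conj (φ.mapVars f) (ψ.mapVars f)
  | disj φ ψ => disj (φ.mapVars f) (ψ.mapVars f)

/-- Evaluation commutes with relabelling. [folklore] -/
@[simp] theorem eval_mapVars (f : ν → μ) (σ : μ → Bool) (φ : PropForm ν) :
    (φ.mapVars f).eval σ = φ.eval (σ ∘ f) := by
  induction φ with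
  | var x => rfl
  | const b => rfl
  | neg φ ih => simp [mapVars, eval, ih]
  | conj φ ψ ih₁ ih₂ => simp [mapVars, eval, ih₁, ih₂]
  | disj φ ψ ih₁ ih₂ => simp [mapVars, eval, ih₁, ih₂]

/-- Relabelling preserves the size. [folklore] -/
@[simp] theorem size_mapVars (f : ν → μ) (φ : PropForm ν) : (φ.mapVars f).size = φ.size := by
  induction φ with
  | var x => rfl
  | const b => rfl
  | neg φ ih => simp [mapVars, size, ih]
  | conj φ ψ ih₁ ih₂ => simp [mapVars, size, ih₁, ih₂]
  | disj φ ψ ih₁ ih₂ => simp [mapVars, size, ih₁, ih₂]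

/-- Functoriality of relabelling. [folklore] -/
theorem mapVars_mapVars {κ : Type u} (f : ν → μ) (g : μ → κ) (φ : PropForm ν) :
    (φ.mapVars f).mapVars g = φ.mapVars (g ∘ f) := by
  induction φ with
  | var x => rfl
  | const b => rfl
  | neg φ ih => simp [mapVars, ih]
  | conj φ ψ ih₁ ih₂ => simp [mapVars, ih₁, ih₂]
  | disj φ ψ ih₁ ih₂ => simp [mapVars, ih₁, ih₂]

/-- Relabelling depends only on the values of the map. [folklore] -/
theorem mapVars_congr {f g : ν → μ} (φ : PropForm ν) (h : ∀ x, f x = g x) :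
    φ.mapVars f = φ.mapVars g := by
  induction φ with
  | var x => simp [mapVars, h]
  | const b => rfl
  | neg φ ih => simp [mapVars, ih]
  | conj φ ψ ih₁ ih₂ => simp [mapVars, ih₁, ih₂]
  | disj φ ψ ih₁ ih₂ => simp [mapVars, ih₁, ih₂]

/-- Relabelling by the identity. [folklore] -/
@[simp] theorem mapVars_id (φ : PropForm ν) : φ.mapVars id = φ := by
  induction φ with
  | var x => rfl
  | const b => rfl
  | neg φ ih => simp [mapVars, ih]
  | conj φ ψ ih₁ ih₂ => simp [mapVars, ih₁, ih₂]
  | disj φ ψ ih₁ ih₂ => simp [mapVars, ih₁, ih₂]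

end PropForm

/-! ### Canonical binary numerals -/

/-- A bit string is a *canonical numeral* if it is empty or its last bit is `true`; these are
exactly the values of Mathlib's binary encoding `encodeNat` (little-endian, no leading zeros).
[folklore] -/
def IsCanonicalNum (l : List Bool) : Prop :=
  l = [] ∨ l.getLast? = some true

/-- Canonicity is decidable. [folklore] -/
instance (l : List Bool) : Decidable (IsCanonicalNum l) := by
  unfold IsCanonicalNum; infer_instance

/-- `encodePosNum p` ends in `true`. [folklore] -/
theorem getLast?_encodePosNum (p : PosNum) : (encodePosNum p).getLast? = some true := by
  induction p with
  | one => rfl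
  | bit1 p ih => simp only [encodePosNum]; rw [List.getLast?_cons, ih]; simp
  | bit0 p ih => simp only [encodePosNum]; rw [List.getLast?_cons, ih]; simp

/-- Values of `encodeNat` are canonical numerals. [folklore] -/
theorem isCanonicalNum_encodeNat (n : ℕ) : IsCanonicalNum (encodeNat n) := by
  unfold encodeNat encodeNum
  cases (n : Num) with
  | zero => exact Or.inl rfl
  | pos p => exact Or.inr (getLast?_encodePosNum p)

/-- `encodePosNum` is a left inverse of `decodePosNum` on nonempty strings ending in `true`.
[folklore] -/
theorem encodePosNum_decodePosNum : ∀ (l : List Bool), l ≠ [] → l.getLast? = some true →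
    encodePosNum (decodePosNum l) = l
  | [], h, _ => absurd rfl h
  | [true], _, _ => rfl
  | [false], _, h => by simp at h
  | true :: b :: l, _, h => by
    have h' : (b :: l).getLast? = some true := by
      rwa [List.getLast?_cons_cons] at h
    have ih := encodePosNum_decodePosNum (b :: l) (List.cons_ne_nil _ _) h'
    simp [decodePosNum, encodePosNum, ih]
  | false :: b :: l, _, h => by
    have h' : (b :: l).getLast? = some true := by
      rwa [List.getLast?_cons_cons] at h
    have ih := encodePosNum_decodePosNum (b :: l) (List.cons_ne_nil _ _) h'
    simp [decodePosNum, encodePosNum, ih]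

/-- On canonical numerals, `encodeNat ∘ decodeNat = id`. [folklore] -/
theorem encodeNat_decodeNat {l : List Bool} (h : IsCanonicalNum l) : encodeNat (decodeNat l) = l := by
  unfold encodeNat decodeNat
  rw [Num.of_to_nat]
  unfold decodeNum
  rcases h with rfl | h
  · rfl
  · have hl : l ≠ [] := by rintro rfl; simp at h
    simp only [hl, if_false]
    rw [PosNum.cast_to_num]
    exact encodePosNum_decodePosNum l hl h

/-- Canonical numerals are exactly the range of `encodeNat`. [folklore] -/
theorem isCanonicalNum_iff (l : List Bool) : IsCanonicalNum l ↔ l ∈ Set.range encodeNat :=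
  ⟨fun h => ⟨decodeNat l, encodeNat_decodeNat h⟩, by rintro ⟨n, rfl⟩; exact isCanonicalNum_encodeNat n⟩

/-! ### Formula tokens (Polish notation) -/

/-- Tokens of the prefix code of a formula: a variable with its binary payload, a constant,
or one of the three connectives. [Arora–Barak 2009, §0.1] [folklore] -/
inductive FTok
  | var (bits : List Bool)
  | const (b : Bool)
  | neg
  | conj
  | disj
  deriving DecidableEq, Repr

/-- The token string of a formula (variables carry bit strings), in prefix (Polish) order.
[folklore] -/
def PropForm.toks : PropForm (List Bool) → List FTok
  | .var bs => [FTok.var bs]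
  | .const b => [FTok.const b]
  | .neg φ => FTok.neg :: φ.toks
  | .conj φ ψ => FTok.conj :: (φ.toks ++ ψ.toks)
  | .disj φ ψ => FTok.disj :: (φ.toks ++ ψ.toks)

/-- The number of tokens is the size. [folklore] -/
@[simp] theorem PropForm.length_toks (φ : PropForm (List Bool)) : φ.toks.length = φ.size := by
  induction φ with
  | var _ => rfl
  | const _ => rfl
  | neg φ ih => simp [PropForm.toks, PropForm.size, ih]
  | conj φ ψ ih₁ ih₂ => simp [PropForm.toks, PropForm.size, ih₁, ih₂]
  | disj φ ψ ih₁ ih₂ => simp [PropForm.toks, PropForm.size, ih₁, ih₂]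

/-- A formula has at least one token. [folklore] -/
theorem PropForm.toks_ne_nil (φ : PropForm (List Bool)) : φ.toks ≠ [] := by
  cases φ <;> simp [PropForm.toks]

/-- The bit code of one token (`PropForm.code`, node by node). [folklore] -/
def FTok.bits : FTok → List Bool
  | var bs => false :: false :: boolPair bs []
  | const b => [false, true, b]
  | neg => [true, false]
  | conj => [true, true, false]
  | disj => [true, true, true]

/-- The bit code of a token string. [folklore] -/
def untok (ts : List FTok) : List Bool := ts.flatMap FTok.bits

/-- Code of the empty token string. [folklore] -/
@[simp] theorem untok_nil : untok [] = [] := rfl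
/-- Code of a token string, first token. [folklore] -/
@[simp] theorem untok_cons (t : FTok) (ts : List FTok) : untok (t :: ts) = t.bits ++ untok ts := rfl
/-- Code of a concatenation. [folklore] -/
@[simp] theorem untok_append (ts ts' : List FTok) : untok (ts ++ ts') = untok ts ++ untok ts' := by
  simp [untok]

/-- `PropForm.code` is the bit code of the token string of the formula with binary variable
payloads. [folklore] -/
theorem PropForm.code_eq_untok_toks (φ : PropForm ℕ) :
    φ.code = untok (φ.mapVars encodeNat).toks := by
  induction φ with
  | var n => simp [PropForm.code, PropForm.mapVars, PropForm.toks, FTok.bits]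
  | const b => rfl
  | neg φ ih => simp [PropForm.code, PropForm.mapVars, PropForm.toks, FTok.bits, ih]
  | conj φ ψ ih₁ ih₂ => simp [PropForm.code, PropForm.mapVars, PropForm.toks, FTok.bits, ih₁, ih₂]
  | disj φ ψ ih₁ ih₂ => simp [PropForm.code, PropForm.mapVars, PropForm.toks, FTok.bits, ih₁, ih₂]

/-- All variable payloads of a token string are canonical numerals. [folklore] -/
def AllCanonical (ts : List FTok) : Prop :=
  ∀ bs, FTok.var bs ∈ ts → IsCanonicalNum bs

/-! ### The tokenizer (a finite-state reading of the prefix code) -/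

/-- Control states of the tokenizer: between tokens; after a first tag bit `0`/`1`; after
`11`; after `01` (a constant's value bit follows); inside a variable payload, expecting the
first / second bit of a pair. [folklore] -/
inductive TkSt
  | start
  | t0
  | t1
  | t11
  | cst
  | pay0
  | pay1 (b : Bool)
  deriving DecidableEq, Repr

/-- The tokenizer, one bit per step (structurally recursive; `acc` is the payload read so
far, in order). Returns `none` on a syntax error, on a non-canonical payload, and on an input
ending inside a token. [folklore] -/
def tokRun : TkSt → List Bool → List Bool → Option (List FTok)
  | .start, _, [] => some []
  | .start, _, false :: r => tokRun .t0 [] r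
  | .start, _, true :: r => tokRun .t1 [] r
  | .t0, _, false :: r => tokRun .pay0 [] r
  | .t0, _, true :: r => tokRun .cst [] r
  | .cst, _, b :: r => (tokRun .start [] r).map (FTok.const b :: ·)
  | .t1, _, false :: r => (tokRun .start [] r).map (FTok.neg :: ·)
  | .t1, _, true :: r => tokRun .t11 [] r
  | .t11, _, false :: r => (tokRun .start [] r).map (FTok.conj :: ·)
  | .t11, _, true :: r => (tokRun .start [] r).map (FTok.disj :: ·)
  | .pay0, acc, b :: r => tokRun (.pay1 b) acc r
  | .pay1 b, acc, b' :: r =>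
    if b = b' then tokRun .pay0 (acc ++ [b]) r
    else if b' = true then
      (if IsCanonicalNum acc then (tokRun .start [] r).map (FTok.var acc :: ·) else none)
    else none
  | _, _, [] => none

/-- The tokenizer of a bit string. [folklore] -/
def tokenize (c : List Bool) : Option (List FTok) := tokRun .start [] c

/-- Reading a doubled payload followed by the terminator `01`. [folklore] -/
theorem tokRun_pay0_boolPair (acc bs r : List Bool) :
    tokRun .pay0 acc (boolPair bs r) =
      if IsCanonicalNum (acc ++ bs) then (tokRun .start [] r).map (FTok.var (acc ++ bs) :: ·)
      else none := by
  induction bs generalizing acc with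
  | nil => simp [boolPair, tokRun]
  | cons b bs ih =>
    have : boolPair (b :: bs) r = b :: b :: boolPair bs r := by simp [boolPair]
    rw [this, tokRun, tokRun, if_pos rfl, ih (acc ++ [b])]
    simp

/-- The tokenizer reads one token code and continues. [folklore] -/
theorem tokRun_start_bits (t : FTok) (ht : ∀ bs, t = FTok.var bs → IsCanonicalNum bs)
    (r : List Bool) : tokRun .start [] (t.bits ++ r) = (tokRun .start [] r).map (t :: ·) := by
  cases t with
  | var bs =>
    have hc := ht bs rfl
    simp only [FTok.bits, List.cons_append]
    rw [tokRun, tokRun]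
    have : boolPair bs [] ++ r = boolPair bs r := by simp [boolPair]
    rw [this, tokRun_pay0_boolPair]
    simp [hc]
  | const b => simp [FTok.bits, tokRun]
  | neg => simp [FTok.bits, tokRun]
  | conj => simp [FTok.bits, tokRun]
  | disj => simp [FTok.bits, tokRun]

/-- The tokenizer inverts `untok` on token strings with canonical payloads. [folklore] -/
theorem tokenize_untok {ts : List FTok} (h : AllCanonical ts) : tokenize (untok ts) = some ts := by
  induction ts with
  | nil => rfl
  | cons t ts ih =>
    have h₁ : ∀ bs, t = FTok.var bs → IsCanonicalNum bs := fun bs ht =>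
      h bs (by simp [ht])
    have h₂ : AllCanonical ts := fun bs hbs => h bs (List.mem_cons_of_mem _ hbs)
    unfold tokenize at ih ⊢
    rw [untok_cons, tokRun_start_bits t h₁, ih h₂]
    rfl

/-- The bits consumed so far inside the current token, as a function of the tokenizer state.
[folklore] -/
def TkSt.consumed : TkSt → List Bool → List Bool
  | .start, _ => []
  | .t0, _ => [false]
  | .t1, _ => [true]
  | .t11, _ => [true, true]
  | .cst, _ => [false, true]
  | .pay0, acc => false :: false :: acc.flatMap fun b => [b, b]
  | .pay1 b, acc => false :: false :: (acc.flatMap fun b => [b, b]) ++ [b]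

/-- **Soundness of the tokenizer**: a successful run reconstructs its input as the code of the
token string, and all payloads read are canonical. [folklore] -/
theorem tokRun_sound : ∀ (st : TkSt) (acc c : List Bool) (ts : List FTok),
    tokRun st acc c = some ts → st.consumed acc ++ c = untok ts ∧ AllCanonical ts
  | .start, acc, [], ts, h => by
    simp [tokRun] at h; subst h; simp [TkSt.consumed, AllCanonical]
  | .start, acc, false :: r, ts, h => by
    rw [tokRun] at h; simpa [TkSt.consumed] using tokRun_sound .t0 [] r ts h
  | .start, acc, true :: r, ts, h => by
    rw [tokRun] at h; simpa [TkSt.consumed] using tokRun_sound .t1 [] r ts h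
  | .t0, acc, false :: r, ts, h => by
    rw [tokRun] at h; simpa [TkSt.consumed] using tokRun_sound .pay0 [] r ts h
  | .t0, acc, true :: r, ts, h => by
    rw [tokRun] at h; simpa [TkSt.consumed] using tokRun_sound .cst [] r ts h
  | .cst, acc, b :: r, ts, h => by
    rw [tokRun] at h
    cases h' : tokRun .start [] r with
    | none => simp [h'] at h
    | some ts' =>
      simp [h'] at h; subst h
      obtain ⟨e, hc⟩ := tokRun_sound .start [] r ts' h'
      refine ⟨by simpa [TkSt.consumed, FTok.bits] using e, ?_⟩
      intro bs hbs; simp at hbs; exact hc bs hbs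
  | .t1, acc, false :: r, ts, h => by
    rw [tokRun] at h
    cases h' : tokRun .start [] r with
    | none => simp [h'] at h
    | some ts' =>
      simp [h'] at h; subst h
      obtain ⟨e, hc⟩ := tokRun_sound .start [] r ts' h'
      refine ⟨by simpa [TkSt.consumed, FTok.bits] using e, ?_⟩
      intro bs hbs; simp at hbs; exact hc bs hbs
  | .t1, acc, true :: r, ts, h => by
    rw [tokRun] at h; simpa [TkSt.consumed] using tokRun_sound .t11 [] r ts h
  | .t11, acc, false :: r, ts, h => by
    rw [tokRun] at h
    cases h' : tokRun .start [] r with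
    | none => simp [h'] at h
    | some ts' =>
      simp [h'] at h; subst h
      obtain ⟨e, hc⟩ := tokRun_sound .start [] r ts' h'
      refine ⟨by simpa [TkSt.consumed, FTok.bits] using e, ?_⟩
      intro bs hbs; simp at hbs; exact hc bs hbs
  | .t11, acc, true :: r, ts, h => by
    rw [tokRun] at h
    cases h' : tokRun .start [] r with
    | none => simp [h'] at h
    | some ts' =>
      simp [h'] at h; subst h
      obtain ⟨e, hc⟩ := tokRun_sound .start [] r ts' h'
      refine ⟨by simpa [TkSt.consumed, FTok.bits] using e, ?_⟩
      intro bs hbs; simp at hbs; exact hc bs hbs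
  | .pay0, acc, b :: r, ts, h => by
    rw [tokRun] at h
    simpa [TkSt.consumed] using tokRun_sound (.pay1 b) acc r ts h
  | .pay1 b, acc, b' :: r, ts, h => by
    rw [tokRun] at h
    by_cases hbb : b = b'
    · subst hbb
      rw [if_pos rfl] at h
      obtain ⟨e, hc⟩ := tokRun_sound .pay0 (acc ++ [b]) r ts h
      exact ⟨by simpa [TkSt.consumed] using e, hc⟩
    · rw [if_neg hbb] at h
      by_cases hb' : b' = true
      · subst hb'
        rw [if_pos rfl] at h
        by_cases hcan : IsCanonicalNum acc
        · rw [if_pos hcan] at h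
          cases h' : tokRun .start [] r with
          | none => simp [h'] at h
          | some ts' =>
            simp [h'] at h; subst h
            obtain ⟨e, hc⟩ := tokRun_sound .start [] r ts' h'
            have hb : b = false := by cases b <;> simp_all
            subst hb
            refine ⟨?_, ?_⟩
            · simp [TkSt.consumed, FTok.bits, boolPair, ← e]
            · intro bs hbs
              simp at hbs
              rcases hbs with rfl | hbs
              · exact hcan
              · exact hc bs hbs
        · rw [if_neg hcan] at h; exact absurd h (by simp)
      · rw [if_neg hb'] at h; exact absurd h (by simp)
  | .t0, _, [], _, h => by simp [tokRun] at h
  | .t1, _, [], _, h => by simp [tokRun] at h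
  | .t11, _, [], _, h => by simp [tokRun] at h
  | .cst, _, [], _, h => by simp [tokRun] at h
  | .pay0, _, [], _, h => by simp [tokRun] at h
  | .pay1 _, _, [], _, h => by simp [tokRun] at h

/-- A successfully tokenized string is the code of its tokens, with canonical payloads.
[folklore] -/
theorem tokenize_sound {c : List Bool} {ts : List FTok} (h : tokenize c = some ts) :
    c = untok ts ∧ AllCanonical ts := by
  simpa [TkSt.consumed] using tokRun_sound .start [] c ts h

/-! ### Reading the unary size header of a formula code -/

/-- Reading `w = boolPair (1ˢ) c` two bits at a time: count the `11` pairs, stop at the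
separator `01`, fail on anything else (a `0` in the unary part, a `10` pair, or a premature
end). The `Option Bool` is the pending first bit of a pair. [folklore] -/
def readHdr : ℕ → Option Bool → List Bool → Option (ℕ × List Bool)
  | s, none, b :: r => readHdr s (some b) r
  | s, some true, true :: r => readHdr (s + 1) none r
  | s, some false, true :: r => some (s, r)
  | _, some _, false :: _ => none
  | _, _, [] => none

/-- `readHdr` on a genuine header. [folklore] -/
theorem readHdr_boolPair_replicate (s₀ s : ℕ) (c : List Bool) :
    readHdr s₀ none (boolPair (List.replicate s true) c) = some (s₀ + s, c) := by
  induction s generalizing s₀ with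
  | zero => simp [boolPair, readHdr]
  | succ s ih =>
    have : boolPair (List.replicate (s + 1) true) c = true :: true :: boolPair (List.replicate s true) c := by
      simp [boolPair, List.replicate_succ]
    rw [this, readHdr, readHdr, ih]; congr 1; simp; omega

/-- **Soundness of `readHdr`**: a successful read reconstructs the input. [folklore] -/
theorem readHdr_sound : ∀ (s₀ : ℕ) (p : Option Bool) (w : List Bool) (s : ℕ) (c : List Bool),
    readHdr s₀ p w = some (s, c) →
      s₀ ≤ s ∧ (p.toList ++ w = boolPair (List.replicate (s - s₀) true) c ∨
        (p = some true ∧ ∃ w', w = true :: w' ∧ w' = boolPair (List.replicate (s - s₀ - 1) true) c ∧ s₀ < s))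
  | s₀, none, b :: r, s, c, h => by
    rw [readHdr] at h
    obtain ⟨hle, h'⟩ := readHdr_sound s₀ (some b) r s c h
    rcases h' with h' | ⟨hb, w', hw', hw'', hlt⟩
    · exact ⟨hle, Or.inl (by simpa using h')⟩
    · cases hb
      refine ⟨hle, Or.inl ?_⟩
      subst hw'
      have hk : s - s₀ = (s - s₀ - 1) + 1 := by omega
      rw [hw'', Option.toList_none, List.nil_append, hk, List.replicate_succ]
      simp [boolPair]
  | s₀, some true, true :: r, s, c, h => by
    rw [readHdr] at h
    obtain ⟨hle, h'⟩ := readHdr_sound (s₀ + 1) none r s c h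
    rcases h' with h' | ⟨hb, _⟩
    · refine ⟨by omega, Or.inr ⟨rfl, r, rfl, ?_, by omega⟩⟩
      have : s - s₀ - 1 = s - (s₀ + 1) := by omega
      rw [this]; simpa using h'
    · simp at hb
  | s₀, some false, true :: r, s, c, h => by
    simp [readHdr] at h
    obtain ⟨rfl, rfl⟩ := h
    exact ⟨le_rfl, Or.inl (by simp [boolPair])⟩
  | _, some _, false :: _, _, _, h => by simp [readHdr] at h
  | _, none, [], _, _, h => by simp [readHdr] at h
  | _, some _, [], _, _, h => by simp [readHdr] at h

/-- Reading the header from the start: success means `w = boolPair 1ˢ c`. [folklore] -/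
theorem readHdr_sound₀ {w : List Bool} {s : ℕ} {c : List Bool} (h : readHdr 0 none w = some (s, c)) :
    w = boolPair (List.replicate s true) c := by
  obtain ⟨-, h' | ⟨hb, _⟩⟩ := readHdr_sound 0 none w s c h
  · simpa using h'
  · simp at hb

/-! ### Right-to-left (reverse Polish) parsing of a token string -/

/-- One step of the reverse-Polish parser: a leaf is pushed, a connective pops its arguments
(the first argument is on top) and pushes the compound formula; `none` on underflow.
[folklore] -/
def rpnStep : List (PropForm (List Bool)) → FTok → Option (List (PropForm (List Bool)))
  | stk, .var bs => some (.var bs :: stk)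
  | stk, .const b => some (.const b :: stk)
  | t :: stk, .neg => some (.neg t :: stk)
  | t₁ :: t₂ :: stk, .conj => some (.conj t₁ t₂ :: stk)
  | t₁ :: t₂ :: stk, .disj => some (.disj t₁ t₂ :: stk)
  | _, _ => none

/-- The reverse-Polish parser on a token list (to be fed the *reversed* token string).
[folklore] -/
def rpn : List FTok → List (PropForm (List Bool)) → Option (List (PropForm (List Bool)))
  | [], stk => some stk
  | t :: ts, stk => (rpnStep stk t).bind (rpn ts)

/-- The parser on a concatenation. [folklore] -/
theorem rpn_append (ts ts' : List FTok) (stk : List (PropForm (List Bool))) :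
    rpn (ts ++ ts') stk = (rpn ts stk).bind (rpn ts') := by
  induction ts generalizing stk with
  | nil => rfl
  | cons t ts ih =>
    simp only [List.cons_append, rpn]
    cases rpnStep stk t with
    | none => rfl
    | some stk' => exact ih stk'

/-- **Completeness of the parser**: the reversed token string of `φ` pushes `φ`. [folklore] -/
theorem rpn_reverse_toks (φ : PropForm (List Bool)) (rest : List FTok)
    (stk : List (PropForm (List Bool))) :
    rpn (φ.toks.reverse ++ rest) stk = rpn rest (φ :: stk) := by
  induction φ generalizing rest stk with
  | var bs => simp [PropForm.toks, rpn, rpnStep]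
  | const b => simp [PropForm.toks, rpn, rpnStep]
  | neg φ ih => simp [PropForm.toks, List.reverse_cons, List.append_assoc, ih, rpn, rpnStep]
  | conj φ ψ ih₁ ih₂ =>
    simp [PropForm.toks, List.reverse_cons, List.reverse_append, List.append_assoc, ih₁, ih₂, rpn,
      rpnStep]
  | disj φ ψ ih₁ ih₂ =>
    simp [PropForm.toks, List.reverse_cons, List.reverse_append, List.append_assoc, ih₁, ih₂, rpn,
      rpnStep]

/-- **Soundness of the parser**: if the reversed token string parses to a stack of formulas,
the token string is the concatenation of their token strings (top of the stack first).
[folklore] -/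
theorem rpn_reverse_sound (ts : List FTok) :
    ∀ stk, rpn ts.reverse [] = some stk → ts = (stk.map PropForm.toks).flatten := by
  induction ts with
  | nil => intro stk h; simp [rpn] at h; subst h; rfl
  | cons t ts ih =>
    intro stk h
    rw [List.reverse_cons, rpn_append] at h
    cases h₁ : rpn ts.reverse [] with
    | none => simp [h₁] at h
    | some stk₁ =>
      rw [h₁, Option.bind_some, rpn] at h
      have e := ih stk₁ h₁
      cases t with
      | var bs => simp [rpnStep, rpn] at h; subst h; simp [PropForm.toks, e]
      | const b => simp [rpnStep, rpn] at h; subst h; simp [PropForm.toks, e]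
      | neg =>
        cases stk₁ with
        | nil => simp [rpnStep] at h
        | cons t₁ stk₁ => simp [rpnStep, rpn] at h; subst h; simp [PropForm.toks, e]
      | conj =>
        rcases stk₁ with _ | ⟨t₁, _ | ⟨t₂, stk₁⟩⟩
        · simp [rpnStep] at h
        · simp [rpnStep] at h
        · simp [rpnStep, rpn] at h; subst h; simp [PropForm.toks, e]
      | disj =>
        rcases stk₁ with _ | ⟨t₁, _ | ⟨t₂, stk₁⟩⟩
        · simp [rpnStep] at h
        · simp [rpnStep] at h
        · simp [rpnStep, rpn] at h; subst h; simp [PropForm.toks, e]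

/-- The parse of a token string: `some φ` iff the reversed string parses to exactly `[φ]`.
[folklore] -/
def parseToks (ts : List FTok) : Option (PropForm (List Bool)) :=
  match rpn ts.reverse [] with
  | some [φ] => some φ
  | _ => none

/-- **Completeness of parsing**: the token string of `φ` parses to `φ`. [folklore] -/
theorem parseToks_toks (φ : PropForm (List Bool)) : parseToks φ.toks = some φ := by
  unfold parseToks
  have := rpn_reverse_toks φ [] []
  rw [List.append_nil] at this
  rw [this]; rfl

/-- **Soundness of parsing**: a parsed token string is the token string of its parse. [folklore] -/
theorem parseToks_sound {ts : List FTok} {φ : PropForm (List Bool)} (h : parseToks ts = some φ) :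
    ts = φ.toks := by
  unfold parseToks at h
  split at h
  · rename_i φ' h'
    simp at h; subst h
    simpa using rpn_reverse_sound ts [φ'] h'
  · simp at h

/-! ### The certificate: an assignment table -/

/-- States of the table reader: expecting the first / second bit of a pair of the current
entry's key (with the comparison flag and the unread query bits), or the entry's value bit.
[folklore] -/
inductive LkSt
  | k0 (m : Bool) (qs : List Bool)
  | k1 (m : Bool) (qs : List Bool) (b : Bool)
  | val (m : Bool)

/-- Table lookup: the certificate is a list of entries `doubled(key) ++ 01 ++ [value]`; return
the value of the first entry whose key equals the query `q`, `false` if there is none (or on a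
malformed table). [folklore] -/
def lookup (q : List Bool) : LkSt → List Bool → Bool
  | .k0 m qs, b :: r => lookup q (.k1 m qs b) r
  | .k1 m qs b, b' :: r =>
    if b = b' then
      (match qs with
        | q₁ :: qs' => lookup q (.k0 (m && (q₁ == b)) qs') r
        | [] => lookup q (.k0 false []) r)
    else if b' = true then lookup q (.val (m && qs.isEmpty)) r
    else false
  | .val m, v :: r => if m then v else lookup q (.k0 true q) r
  | _, [] => false

/-- The assignment defined by a certificate `y`: `σ_y q = lookup of the key q`. [folklore] -/
def certAssignment (y : List Bool) (q : List Bool) : Bool :=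
  lookup q (.k0 true q) y

/-- One table entry. [folklore] -/
def entry (key : List Bool) (v : Bool) : List Bool :=
  boolPair key [v]

/-- Reading the key of an entry against a query. [folklore] -/
theorem lookup_k0_boolPair (q : List Bool) (m : Bool) (qs key r : List Bool) :
    lookup q (.k0 m qs) (boolPair key r) = lookup q (.val (m && decide (qs = key))) r := by
  induction key generalizing m qs with
  | nil =>
    simp only [boolPair, List.flatMap_nil, List.nil_append, List.cons_append]
    simp only [lookup]
    cases qs <;> simp
  | cons k key ih =>
    have : boolPair (k :: key) r = k :: k :: boolPair key r := by simp [boolPair]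
    rw [this]
    cases qs with
    | nil => simp [lookup, ih]
    | cons q₁ qs' =>
      simp only [lookup, if_true, ih]
      congr 2
      cases m <;> cases q₁ <;> cases k <;> simp

/-- Lookup through one entry: hit or continue. [folklore] -/
theorem certAssignment_lookup_entry (q key : List Bool) (v : Bool) (r : List Bool) :
    lookup q (.k0 true q) (entry key v ++ r) = if q = key then v else lookup q (.k0 true q) r := by
  unfold entry
  have : boolPair key [v] ++ r = boolPair key (v :: r) := by simp [boolPair]
  rw [this, lookup_k0_boolPair]
  by_cases h : q = key <;> simp [h, lookup]

/-- The table of an assignment on a list of keys. [folklore] -/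
def table (σ : List Bool → Bool) (keys : List (List Bool)) : List Bool :=
  (keys.map fun k => entry k (σ k)).flatten

/-- The assignment of a table agrees with the tabulated assignment on the tabulated keys.
[folklore] -/
theorem certAssignment_table (σ : List Bool → Bool) (keys : List (List Bool)) (q : List Bool)
    (hq : q ∈ keys) : certAssignment (table σ keys) q = σ q := by
  unfold certAssignment
  induction keys with
  | nil => simp at hq
  | cons k keys ih =>
    simp only [table, List.map_cons, List.flatten_cons] at ih ⊢
    rw [certAssignment_lookup_entry]
    by_cases h : q = k
    · subst h; simp
    · rw [if_neg h]
      exact ih (by simpa [h] using hq)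

/-- Length of a table: `2|key| + 3` per entry. [folklore] -/
theorem length_table (σ : List Bool → Bool) (keys : List (List Bool)) :
    (table σ keys).length = (keys.map fun k => 2 * k.length + 3).sum := by
  induction keys with
  | nil => rfl
  | cons k keys ih => simp [table, entry] at ih ⊢; omega

/-! ### Variables of a formula -/

namespace PropForm

variable {ν : Type u} {μ : Type v}

/-- The list of variable occurrences of a formula, in prefix order. [folklore] -/
def varList : PropForm ν → List ν
  | var x => [x]
  | const _ => []
  | neg φ => φ.varList
  | conj φ ψ => φ.varList ++ ψ.varList
  | disj φ ψ => φ.varList ++ ψ.varList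

/-- Evaluation depends only on the values of the occurring variables. [folklore] -/
theorem eval_congr {σ τ : ν → Bool} (φ : PropForm ν) (h : ∀ x ∈ φ.varList, σ x = τ x) :
    φ.eval σ = φ.eval τ := by
  induction φ with
  | var x => exact h x (by simp [varList])
  | const b => rfl
  | neg φ ih => simp only [eval]; rw [ih h]
  | conj φ ψ ih₁ ih₂ =>
    simp only [eval, varList, List.mem_append] at h ⊢
    rw [ih₁ fun x hx => h x (Or.inl hx), ih₂ fun x hx => h x (Or.inr hx)]
  | disj φ ψ ih₁ ih₂ =>
    simp only [eval, varList, List.mem_append] at h ⊢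
    rw [ih₁ fun x hx => h x (Or.inl hx), ih₂ fun x hx => h x (Or.inr hx)]

/-- Relabelling depends only on the images of the occurring variables. [folklore] -/
theorem mapVars_congr_mem {f g : ν → μ} (φ : PropForm ν) (h : ∀ x ∈ φ.varList, f x = g x) :
    φ.mapVars f = φ.mapVars g := by
  induction φ with
  | var x => simp [mapVars, h x (by simp [varList])]
  | const b => rfl
  | neg φ ih => simp only [mapVars]; rw [ih h]
  | conj φ ψ ih₁ ih₂ =>
    simp only [mapVars, varList, List.mem_append] at h ⊢
    rw [ih₁ fun x hx => h x (Or.inl hx), ih₂ fun x hx => h x (Or.inr hx)]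
  | disj φ ψ ih₁ ih₂ =>
    simp only [mapVars, varList, List.mem_append] at h ⊢
    rw [ih₁ fun x hx => h x (Or.inl hx), ih₂ fun x hx => h x (Or.inr hx)]

/-- Variable occurrences of a relabelled formula. [folklore] -/
@[simp] theorem varList_mapVars (f : ν → μ) (φ : PropForm ν) :
    (φ.mapVars f).varList = φ.varList.map f := by
  induction φ with
  | var x => rfl
  | const b => rfl
  | neg φ ih => simpa [mapVars, varList] using ih
  | conj φ ψ ih₁ ih₂ => simp [mapVars, varList, ih₁, ih₂]
  | disj φ ψ ih₁ ih₂ => simp [mapVars, varList, ih₁, ih₂]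

/-- Variable tokens are variable occurrences. [folklore] -/
theorem var_mem_toks_iff (φ : PropForm (List Bool)) (bs : List Bool) :
    FTok.var bs ∈ φ.toks ↔ bs ∈ φ.varList := by
  induction φ with
  | var x => simp [toks, varList]
  | const b => simp [toks, varList]
  | neg φ ih => simpa [toks, varList] using ih
  | conj φ ψ ih₁ ih₂ => simp [toks, varList, ih₁, ih₂]
  | disj φ ψ ih₁ ih₂ => simp [toks, varList, ih₁, ih₂]

/-- The table over the variable occurrences of `φ` is no longer than the code of `φ`.
[folklore] -/
theorem sum_varList_le_length_code (φ : PropForm ℕ) :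
    (φ.varList.map fun n => 2 * (encodeNat n).length + 3).sum ≤ φ.code.length := by
  induction φ with
  | var n => simp [varList, code]
  | const b => simp [varList, code]
  | neg φ ih => simp only [varList, code, List.length_cons]; omega
  | conj φ ψ ih₁ ih₂ =>
    simp only [varList, code, List.map_append, List.sum_append, List.length_cons,
      List.length_append]; omega
  | disj φ ψ ih₁ ih₂ =>
    simp only [varList, code, List.map_append, List.sum_append, List.length_cons,
      List.length_append]; omega

end PropForm

/-- Mathlib's unary numerals are blocks of `true`. [folklore] -/
theorem unaryEncodeNat_eq_replicate (n : ℕ) : unaryEncodeNat n = List.replicate n true := by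
  induction n with
  | zero => rfl
  | succ n ih => simp [unaryEncodeNat, ih, List.replicate_succ]

/-! ### The co-certificate checker for `TAUT` -/

/-- **The certificate checker for non-tautologies.** On an instance `w` and a certificate `y`:
read the unary size header of `w` (`readHdr`), tokenize the rest (`tokenize`, which also
checks that variable payloads are canonical numerals), compare the token count with the size
header, parse the token string in reverse Polish order (`parseToks`); any failure means that
`w` is not the code of a formula, and the checker *accepts* (`w ∉ TAUT` trivially). Otherwise
`w = code φ`, and the checker accepts iff `φ` is false under the assignment read off the
table `y` (`certAssignment`). [Cook 1971, §1; Arora–Barak 2009, Example 2.21 (a falsifying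
assignment certifies non-membership in TAUT)] [cite: AroraBarakCC2009, Example 2.21] -/
def chkTaut (w y : List Bool) : Bool :=
  match readHdr 0 none w with
  | none => true
  | some (s, c) =>
    match tokenize c with
    | none => true
    | some ts =>
      if ts.length ≠ s then true
      else
        match parseToks ts with
        | none => true
        | some φ => !φ.eval (certAssignment y)

/-- The checker on a genuine formula code: it evaluates the formula under the certificate's
assignment. [folklore] -/
theorem chkTaut_encode (φ : PropForm ℕ) (y : List Bool) :
    chkTaut (encodingPropForm.encode φ) y = !φ.eval (certAssignment y ∘ encodeNat) := by
  have hcan : AllCanonical (φ.mapVars encodeNat).toks := by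
    intro bs hbs
    rw [PropForm.var_mem_toks_iff, PropForm.varList_mapVars, List.mem_map] at hbs
    obtain ⟨n, -, rfl⟩ := hbs
    exact isCanonicalNum_encodeNat n
  change chkTaut (boolPair (unaryEncodeNat φ.size) φ.code) y = _
  unfold chkTaut
  rw [unaryEncodeNat_eq_replicate, readHdr_boolPair_replicate, Nat.zero_add]
  simp only [PropForm.code_eq_untok_toks, tokenize_untok hcan, PropForm.length_toks,
    PropForm.size_mapVars, ne_eq, not_true_eq_false, if_false, parseToks_toks,
    PropForm.eval_mapVars]

/-- The checker accepts every non-codeword, whatever the certificate. [folklore] -/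
theorem chkTaut_of_not_mem_range {w : List Bool} (hw : w ∉ Set.range encodingPropForm.encode)
    (y : List Bool) : chkTaut w y = true := by
  unfold chkTaut
  split
  · rfl
  · rename_i s c hread
    have hw₁ := readHdr_sound₀ hread
    split
    · rfl
    · rename_i ts htok
      obtain ⟨hc, hcan⟩ := tokenize_sound htok
      split
      · rfl
      · rename_i hlen
        rw [Decidable.not_not] at hlen
        split
        · rfl
        · rename_i φ hparse
          exfalso
          have hts := parseToks_sound hparse
          refine hw ⟨φ.mapVars decodeNat, ?_⟩
          have hφ : (φ.mapVars decodeNat).mapVars encodeNat = φ := by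
            rw [PropForm.mapVars_mapVars]
            conv_rhs => rw [← PropForm.mapVars_id φ]
            refine PropForm.mapVars_congr_mem φ fun bs hbs => ?_
            exact encodeNat_decodeNat (hcan bs (by rw [hts, PropForm.var_mem_toks_iff]; exact hbs))
          change boolPair (unaryEncodeNat (φ.mapVars decodeNat).size) (φ.mapVars decodeNat).code = w
          rw [hw₁, hc, hts, unaryEncodeNat_eq_replicate, PropForm.code_eq_untok_toks, hφ,
            PropForm.size_mapVars, ← hlen, hts, PropForm.length_toks]

/-- **The `NP` presentation of the non-tautologies**: `w ∉ TAUT` iff some certificate of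
length `≤ |w|` is accepted by `chkTaut`. (⇒) a codeword `code φ` of a non-tautology has a
falsifying assignment, whose table over the variables of `φ` is accepted; a non-codeword is
accepted with the empty certificate. (⇐) an accepted certificate for `code φ` falsifies `φ`.
[Cook 1971, §1; Arora–Barak 2009, Example 2.21] [cite: AroraBarakCC2009, Example 2.21] -/
theorem not_mem_TAUT_iff (w : List Bool) :
    w ∉ TAUT ↔ ∃ y : List Bool, y.length ≤ w.length ∧ chkTaut w y = true := by
  constructor
  · intro hw
    by_cases hr : w ∈ Set.range encodingPropForm.encode
    · obtain ⟨φ, rfl⟩ := hr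
      rw [mem_TAUT_iff] at hw
      unfold PropForm.IsTautology at hw
      push Not at hw
      obtain ⟨σ, hσ⟩ := hw
      refine ⟨table (σ ∘ decodeNat) (φ.varList.map encodeNat), ?_, ?_⟩
      · rw [length_table, List.map_map]
        change (φ.varList.map fun n => 2 * (encodeNat n).length + 3).sum ≤ _
        refine (PropForm.sum_varList_le_length_code φ).trans ?_
        change φ.code.length ≤ (boolPair (unaryEncodeNat φ.size) φ.code).length
        rw [length_boolPair]; omega
      · rw [chkTaut_encode]
        have hσ' : φ.eval σ = false := by simpa using hσ
        rw [PropForm.eval_congr φ (τ := σ), hσ']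
        · rfl
        · intro n hn
          simp only [Function.comp_apply]
          rw [certAssignment_table _ _ _ (List.mem_map_of_mem hn), Function.comp_apply,
            decode_encodeNat]
    · exact ⟨[], by simp, chkTaut_of_not_mem_range hr []⟩
  · rintro ⟨y, -, hy⟩ hw
    obtain ⟨φ, hφ, rfl⟩ := hw
    rw [chkTaut_encode] at hy
    have := hφ (certAssignment y ∘ encodeNat)
    simp [this] at hy

/-! ### From a polynomial-time checker to `TAUT ∈ coNP` -/

/-- A total string function with values in `{[true], [false]}` decides, in the sense of
`PolyTimeDecidable`, the language of strings it maps to `[true]`. [folklore] -/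
theorem mem_P_of_boolValued {f : List Bool → List Bool} (hf : f ∈ FP)
    (hval : ∀ z, f z = [true] ∨ f z = [false]) : {z | f z = [true]} ∈ Classes.P := by
  set L' : Set (List Bool) := {z | f z = [true]} with hL'
  refine mem_P_iff_holds.2 (polyTimeDecidable_iff.2 ?_)
  refine PolyTimeComputable.of_encode hf id (fun _ => rfl) fun z => ?_
  change f z = encodeBool (L'.boolIndicator z)
  rcases hval z with h | h
  · have hz : z ∈ L' := h
    rw [(Set.mem_iff_boolIndicator _ _).1 hz]; exact h
  · have hz : z ∉ L' := by simp [hL', h]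
    rw [(Set.notMem_iff_boolIndicator _ _).1 hz]; exact h

/-- **`TAUT ∈ coNP` from a polynomial-time implementation of the checker.** If some `f ∈ FP`
with values in `{[true], [false]}` computes `chkTaut` on pairs, `f ⟨w, y⟩ = [chkTaut w y]`, then
the complement of `TAUT` is `polyExists` of the `P`-language `{z | f z = [true]}` with the
linear witness bound of `not_mem_TAUT_iff`, i.e. `TAUTᶜ ∈ NP`. [Cook 1971, §1; Arora–Barak
2009, Example 2.21, Def. 2.19–2.20] [cite: AroraBarakCC2009, Example 2.21] -/
theorem TAUT_mem_coNP_of_checker {f : List Bool → List Bool} (hf : f ∈ FP)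
    (hval : ∀ z, f z = [true] ∨ f z = [false])
    (hspec : ∀ w y, f (boolPair w y) = [chkTaut w y]) : TAUT ∈ coNP := by
  change TAUTᶜ ∈ polyExists Classes.P
  refine ⟨{z | f z = [true]}, mem_P_of_boolValued hf hval, Polynomial.X, fun w => ?_⟩
  change w ∉ TAUT ↔ _
  rw [not_mem_TAUT_iff, Polynomial.eval_X]
  refine exists_congr fun y => and_congr_right fun _ => ?_
  change _ ↔ f (boolPair w y) = [true]
  rw [hspec]; simp

end Literature.Computability.Complexity
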